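import Literature.AlgebraicGeometry.HodgeTheory.QuaternionicQuarticFermatMember
import Literature.AlgebraicGeometry.PlaneCurves.AffineNodalCurvesLines
import HarnessLib

/-!
# The Fermat member: its branch curve is NODAL in the main chart `U₁ = (s, y)` of `𝔽₂`

Layer `Literature/AlgebraicGeometry/HodgeTheory`, namespace `Literature.AlgebraicGeometry.HodgeTheory.Q8Family`. Theorems only (no
definition, no named fact). Written by the prover seat `leafhand-hodge-q8symplecticpowers-4` (g5, cell `pub-hsemireg`) as part (T2a)
of target (T2) «one explicit nodal member for every even `e`» of memo NINTH-HAND-S1-DESIGN-leafhand4-g5 (route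
`HodgeConjecture/Q8SymplecticPowers`, crux K1Q, stmt-HodgeConjecture-24190, stub S1; consumer: the hypothesis `hNod` of
`Q8SymplecticPowersRegularOfNodalBranchCurve.stub_regularVeryGeneralQ_of_nodalDoubleCoverFact`, clause `IsNodal G₂`).

For the Fermat member (`QuaternionicQuarticFermatMember`: `c* = x₀ + 2x₂`, `ψ* = x₀^{e−1} + x₁^{e−1} + x₂^{e−1}`, `dinv = 1`) the
branch form of the double plane in the chart `(s, y)` is `G₂ = (s³ − s) · y · Ψ₂`, `Ψ₂ = (s²y − 2)^d + (y − 2)^d + 1`, `d = e − 1`.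
We prove, for `d` odd and `d ≥ 3` (every even `e ≥ 4`), that `G₂ = 0` is a NODAL affine curve (`AffineNodalCurves.IsNodal`):
* `s³ − s = 0` (three parallel lines) is smooth; it meets `y = 0` transversally (`∂_s(s³ − s) = 3s² − 1 ∈ {−1, 2}` at its zeros);
* `Ψ₂ = 0` is smooth: `∂_sΨ₂ = 2d·sy·(s²y−2)^{d−1}`, `∂_yΨ₂ = d·(s²(s²y−2)^{d−1} + (y−2)^{d−1})`; a common zero forces `y = 0`
  (but `Ψ₂(s,0) = 1 − 2^e ≠ 0`), or `s = 0, y = 2` (but `Ψ₂(0,2) = 1 − 2^d ≠ 0`), or `s²y = 2, y = 2` (but then `Ψ₂ = 1`);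
* `Ψ₂ = 0` misses `y = 0` and meets the lines `s ∈ {0, ±1}` transversally (`∂_yΨ₂ ≠ 0` there by the same evaluations);
assembled with `IsNodal.mul` (p827955). The other three charts (T2b) and the exactness clause `IsChartExact e 1 G₂` are NOT done here.
Honest scope: explicit calculus for one member; nothing here bears on HC; S1 ∕ K1Q NOT proved here.

References: [Fulton2008] §3.1 (nodes); [Zariski1929]; [Naie2007] §1.2 — as in the files this one extends.
-/

noncomputable section

open MvPolynomial
open Literature.AlgebraicGeometry.PlaneCurves.SingularPointsEnvelopes Literature.AlgebraicGeometry.PlaneCurves.AffineNodalCurves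

namespace Literature.AlgebraicGeometry.HodgeTheory.Q8Family

/-! ### Arithmetic in `ℂ` -/

/-- `1 − 2^n ≠ 0` in `ℂ` for `n ≥ 1`. [folklore] -/
private theorem one_sub_two_pow_ne_zero {n : ℕ} (hn : 1 ≤ n) : (1 : ℂ) - 2 ^ n ≠ 0 := by
  intro h
  have h2 : ((2 ^ n : ℕ) : ℂ) = ((1 : ℕ) : ℂ) := by push_cast; linear_combination -h
  have h3 : 2 ^ n = 1 := by exact_mod_cast h2
  have h4 : 2 ≤ 2 ^ n := by
    calc 2 = 2 ^ 1 := by norm_num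
      _ ≤ 2 ^ n := Nat.pow_le_pow_right (by norm_num) hn
  omega

/-- `(−2)^n + 1 ≠ 0` in `ℂ` for odd `n`. [folklore] -/
private theorem neg_two_pow_add_one_ne_zero {n : ℕ} (hn : Odd n) : (-2 : ℂ) ^ n + 1 ≠ 0 := by
  rw [hn.neg_pow]
  intro h
  exact one_sub_two_pow_ne_zero hn.pos (by linear_combination h)

/-! ### The three vertical lines `s³ − s = 0` -/

/-- `∇(s³ − s)(p) = (3s² − 1, 0)`. [cite: Fulton2008, §3.1 (tangent lines)] -/
theorem grad_cubic (p : Fin 2 → ℂ) :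
    grad (X 0 * (X 0 - 1) * (X 0 + 1) : MvPolynomial (Fin 2) ℂ) p = ![3 * p 0 ^ 2 - 1, 0] := by
  have h : (X 0 * (X 0 - 1) * (X 0 + 1) : MvPolynomial (Fin 2) ℂ) = X 0 ^ 3 - X 0 := by ring
  rw [h]
  funext i
  fin_cases i
  · simp [grad_apply, pderiv_X]
  · simp [grad_apply, pderiv_X]

/-- `(s³ − s)(p) = s³ − s`. [folklore] -/
private theorem eval_cubic (p : Fin 2 → ℂ) :
    MvPolynomial.eval p (X 0 * (X 0 - 1) * (X 0 + 1) : MvPolynomial (Fin 2) ℂ) = p 0 * (p 0 - 1) * (p 0 + 1) := by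
  simp

/-- At a zero of `s³ − s`, `3s² − 1 ≠ 0`. [folklore] -/
private theorem three_mul_sq_sub_one_ne_zero {s : ℂ} (hs : s * (s - 1) * (s + 1) = 0) : 3 * s ^ 2 - 1 ≠ 0 := by
  rcases mul_eq_zero.1 hs with h | h
  · rcases mul_eq_zero.1 h with h | h
    · rw [h]; norm_num
    · have : s = 1 := by linear_combination h
      rw [this]; norm_num
  · have : s = -1 := by linear_combination h
    rw [this]; norm_num

/-- The three lines `s ∈ {0, 1, −1}` form a nodal (indeed smooth) curve. [cite: Fulton2008, §3.1 (lines; simple points)] -/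
theorem isNodal_cubic : IsNodal (X 0 * (X 0 - 1) * (X 0 + 1) : MvPolynomial (Fin 2) ℂ) := by
  refine isNodal_of_forall_not_isSingularPoint fun p hp => ?_
  have h0 := congrFun hp.2 0
  rw [grad_cubic] at h0
  have hz := hp.1
  rw [eval_cubic] at hz
  exact three_mul_sq_sub_one_ne_zero hz (by simpa using h0)

/-- `(s³ − s)·y = 0` is nodal (the lines meet `y = 0` transversally). [cite: Fulton2008, §3.1 (nodes)] -/
theorem isNodal_cubic_mul_X_one : IsNodal (X 0 * (X 0 - 1) * (X 0 + 1) * X 1 : MvPolynomial (Fin 2) ℂ) := by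
  refine IsNodal.mul isNodal_cubic (isNodal_X 1) fun p hL _ => ?_
  have hj : jac (X 0 * (X 0 - 1) * (X 0 + 1)) (X 1 : MvPolynomial (Fin 2) ℂ) p = 3 * p 0 ^ 2 - 1 := by
    have h := jac_X_one_sub_C (0 : ℂ) (X 0 * (X 0 - 1) * (X 0 + 1) : MvPolynomial (Fin 2) ℂ) p
    rw [map_zero, sub_zero] at h
    rw [jac_swap, h, neg_neg, grad_cubic]
    simp
  rw [hj]
  rw [eval_cubic] at hL
  exact three_mul_sq_sub_one_ne_zero hL

/-! ### The curve `Ψ₂ = 0` of the Fermat member -/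

/-- `∂_sΨ₂(p) = d·(s²y − 2)^{d−1}·(2sy)`. [cite: Fulton2008, §3.1 (tangent lines)] -/
theorem grad_planeΨ₂_fermatParam_zero (e : ℕ) (p : Fin 2 → ℂ) :
    grad (planeΨ₂ (fermatParam e) 1) p 0 = (e - 1 : ℕ) * (p 0 ^ 2 * p 1 - 2) ^ (e - 1 - 1) * (2 * p 0 * p 1) := by
  rw [planeΨ₂_fermatParam, grad_apply]
  simp [pderiv_X]
  ring

/-- `∂_yΨ₂(p) = d·(s²y − 2)^{d−1}·s² + d·(y − 2)^{d−1}`. [cite: Fulton2008, §3.1 (tangent lines)] -/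
theorem grad_planeΨ₂_fermatParam_one (e : ℕ) (p : Fin 2 → ℂ) :
    grad (planeΨ₂ (fermatParam e) 1) p 1 =
      (e - 1 : ℕ) * (p 0 ^ 2 * p 1 - 2) ^ (e - 1 - 1) * p 0 ^ 2 + (e - 1 : ℕ) * (p 1 - 2) ^ (e - 1 - 1) := by
  rw [planeΨ₂_fermatParam, grad_apply]
  simp [pderiv_X]
  ring

/-- **`∂_yΨ₂ ≠ 0` at the points of `Ψ₂ = 0` on the lines `s³ = s`** (transversality of `Ψ̃` to `f₀, f₁, f₋₁`), for `d = e − 1`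
odd and `≥ 3`. [cite: Fulton2008, §3.1 (ordinary multiple points)] -/
theorem grad_planeΨ₂_fermatParam_one_ne_zero {e : ℕ} (he : Odd (e - 1)) (h3 : 3 ≤ e - 1) (p : Fin 2 → ℂ)
    (hs : p 0 * (p 0 - 1) * (p 0 + 1) = 0) (hΨ : MvPolynomial.eval p (planeΨ₂ (fermatParam e) 1) = 0) :
    grad (planeΨ₂ (fermatParam e) 1) p 1 ≠ 0 := by
  have hd0 : e - 1 ≠ 0 := by omega
  have hd : ((e - 1 : ℕ) : ℂ) ≠ 0 := by exact_mod_cast hd0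
  have hd1 : e - 1 - 1 ≠ 0 := by omega
  rw [eval_planeΨ₂_fermatParam] at hΨ
  rw [grad_planeΨ₂_fermatParam_one]
  intro h
  rcases mul_eq_zero.1 hs with h' | h'
  · rcases mul_eq_zero.1 h' with h0 | h1
    · -- `s = 0`: `d (y-2)^{d-1} = 0` forces `y = 2`, but `Ψ₂(0,2) = (-2)^d + 1 ≠ 0`
      rw [h0] at h hΨ
      have hy : (p 1 - 2) ^ (e - 1 - 1) = 0 := by
        have : ((e - 1 : ℕ) : ℂ) * (p 1 - 2) ^ (e - 1 - 1) = 0 := by linear_combination h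
        exact (mul_eq_zero.1 this).resolve_left hd
      have hy2 : p 1 = 2 := by linear_combination pow_eq_zero_iff hd1 |>.1 hy
      rw [hy2] at hΨ
      have h22 : ((0 : ℂ) ^ 2 * 2 - 2) ^ (e - 1) + (2 - 2) ^ (e - 1) + 1 = (-2) ^ (e - 1) + 1 := by
        rw [show ((2 : ℂ) - 2) = 0 by norm_num, zero_pow hd0]
        ring
      rw [h22] at hΨ
      exact neg_two_pow_add_one_ne_zero he hΨ
    · -- `s = 1`
      have h1' : p 0 = 1 := by linear_combination h1
      rw [h1'] at h hΨ
      have hy : (p 1 - 2) ^ (e - 1 - 1) = 0 := by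
        have : ((e - 1 : ℕ) : ℂ) * (p 1 - 2) ^ (e - 1 - 1) * 2 = 0 := by linear_combination h
        exact (mul_eq_zero.1 ((mul_eq_zero.1 this).resolve_right two_ne_zero)).resolve_left hd
      have hy2 : p 1 = 2 := by linear_combination pow_eq_zero_iff hd1 |>.1 hy
      rw [hy2] at hΨ
      norm_num [zero_pow hd0] at hΨ
  · -- `s = -1`
    have h1' : p 0 = -1 := by linear_combination h'
    rw [h1'] at h hΨ
    have hy : (p 1 - 2) ^ (e - 1 - 1) = 0 := by
      have : ((e - 1 : ℕ) : ℂ) * (p 1 - 2) ^ (e - 1 - 1) * 2 = 0 := by linear_combination h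
      exact (mul_eq_zero.1 ((mul_eq_zero.1 this).resolve_right two_ne_zero)).resolve_left hd
    have hy2 : p 1 = 2 := by linear_combination pow_eq_zero_iff hd1 |>.1 hy
    rw [hy2] at hΨ
    norm_num [zero_pow hd0] at hΨ

/-- **`Ψ₂ = 0` is a smooth affine curve** for `d = e − 1` odd and `≥ 3`. [cite: Fulton2008, §3.1 (simple points)] -/
theorem not_isSingularPoint_planeΨ₂_fermatParam {e : ℕ} (he : Odd (e - 1)) (h3 : 3 ≤ e - 1) (p : Fin 2 → ℂ) :
    ¬ IsSingularPoint (planeΨ₂ (fermatParam e) 1) p := by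
  rintro ⟨hΨ, hg⟩
  have hd : ((e - 1 : ℕ) : ℂ) ≠ 0 := by exact_mod_cast (show e - 1 ≠ 0 by omega)
  have hd1 : e - 1 - 1 ≠ 0 := by omega
  have g0 := congrFun hg 0
  have g1 := congrFun hg 1
  rw [grad_planeΨ₂_fermatParam_zero] at g0
  rw [grad_planeΨ₂_fermatParam_one] at g1
  simp only [Pi.zero_apply] at g0 g1
  have hΨ' := hΨ
  rw [eval_planeΨ₂_fermatParam] at hΨ'
  -- from `∂_sΨ₂ = 0`: `(s²y-2)^{d-1} = 0 ∨ s = 0 ∨ y = 0`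
  rcases mul_eq_zero.1 g0 with g0' | hsy
  · rcases mul_eq_zero.1 g0' with g0'' | hA
    · exact hd g0''
    · -- `(s²y - 2)^{d-1} = 0`: then `∂_yΨ₂ = d (y-2)^{d-1} = 0`, `y = 2`, `s²·2 = 2`, `Ψ₂ = 1`
      have hA' : p 0 ^ 2 * p 1 - 2 = 0 := pow_eq_zero_iff hd1 |>.1 hA
      rw [hA, mul_zero, zero_mul, zero_add] at g1
      have hy : (p 1 - 2) ^ (e - 1 - 1) = 0 := (mul_eq_zero.1 g1).resolve_left hd
      have hy' : p 1 - 2 = 0 := pow_eq_zero_iff hd1 |>.1 hy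
      rw [hA', hy', zero_pow (by omega), zero_add, zero_add] at hΨ'
      exact one_ne_zero hΨ'
  · rcases mul_eq_zero.1 hsy with hs2 | hy0
    · -- `2 s = 0`
      have hs : p 0 = 0 := by
        rcases mul_eq_zero.1 hs2 with h | h
        · norm_num at h
        · exact h
      exact grad_planeΨ₂_fermatParam_one_ne_zero he h3 p (by rw [hs]; ring) hΨ
        (by rw [grad_planeΨ₂_fermatParam_one]; exact g1)
    · -- `y = 0`: `Ψ₂(s, 0) ≠ 0`
      exact eval_planeΨ₂_fermatParam_ne_zero_of_y_eq_zero he p hy0 hΨ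

/-- `Ψ₂ = 0` is a nodal curve (it is smooth). [cite: Fulton2008, §3.1 (simple points)] -/
theorem isNodal_planeΨ₂_fermatParam {e : ℕ} (he : Odd (e - 1)) (h3 : 3 ≤ e - 1) : IsNodal (planeΨ₂ (fermatParam e) 1) :=
  isNodal_of_forall_not_isSingularPoint (not_isSingularPoint_planeΨ₂_fermatParam he h3)

/-! ### The branch curve of the Fermat member is nodal in the chart `(s, y)` -/

/-- **(T2a) The branch curve `G₂ = (s³ − s)·y·Ψ₂ = 0` of the Fermat member is NODAL in the chart `U₁ = (s, y)`**, for
`d = e − 1` odd and `≥ 3` (every even `e ≥ 4`). [cite: Fulton2008, §3.1 (ordinary multiple points)] [cite: Zariski1929] -/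
theorem isNodal_planeG₂_fermatParam {e : ℕ} (he : Odd (e - 1)) (h3 : 3 ≤ e - 1) : IsNodal (planeG₂ (fermatParam e) 1) := by
  rw [planeG₂_fermatParam_factor, ← planeΨ₂_fermatParam]
  refine IsNodal.mul isNodal_cubic_mul_X_one (isNodal_planeΨ₂_fermatParam he h3) fun p hLy hΨ => ?_
  -- `(s³ - s)·y = 0` and `Ψ₂ = 0`: `y ≠ 0`, so `s³ = s`
  have hy : p 1 ≠ 0 := fun hy => eval_planeΨ₂_fermatParam_ne_zero_of_y_eq_zero he p hy hΨ
  rw [map_mul, eval_X, eval_cubic] at hLy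
  have hL : p 0 * (p 0 - 1) * (p 0 + 1) = 0 := (mul_eq_zero.1 hLy).resolve_right hy
  -- the Jacobian: `∇((s³-s)y) = (y(3s²-1), s³-s) = (y(3s²-1), 0)`, so `jac = y (3s² - 1) ∂_yΨ₂`
  have hg0 : grad (X 0 * (X 0 - 1) * (X 0 + 1) * X 1 : MvPolynomial (Fin 2) ℂ) p 0 = (3 * p 0 ^ 2 - 1) * p 1 := by
    rw [grad_mul_apply, grad_cubic, eval_X, eval_cubic, hL, zero_mul, add_zero]
    simp
  have hg1 : grad (X 0 * (X 0 - 1) * (X 0 + 1) * X 1 : MvPolynomial (Fin 2) ℂ) p 1 = 0 := by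
    rw [grad_mul_apply, grad_cubic, eval_cubic, hL, zero_mul, add_zero]
    simp
  unfold jac
  rw [hg0, hg1, zero_mul, sub_zero]
  exact mul_ne_zero (mul_ne_zero (three_mul_sq_sub_one_ne_zero hL) hy)
    (grad_planeΨ₂_fermatParam_one_ne_zero he h3 p hL hΨ)

end Literature.AlgebraicGeometry.HodgeTheory.Q8Family

end
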